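import Summits.HodgeConjecture.HodgeConjecture.Theorems.PadicSemiregularLiftHodgeFermatVarietiesFibreOfProgressionGeneralTwin

/-!
# GP without the twin exclusion, VIII — classification, reachability and the HC pay-off `CoprimeSix.hodgeConjectureFor_general₂`

Part 8 of 9 (Sketch Part 2 tail, ll. 1678–1803; TREE namespace `…CancelByAnyClaimLattice.CoprimeSix`; the line's eight `local notation3` verbatim from
`Theorems/…GeneralPayoff`): **`coprimeClassification_general₂`** (Aoki's Theorem A one prime down WITHOUT the twin exclusion: `p₁ ≥ 11` prime, all primes of `m`
`≥ p₁`, `p₁² ∤ m`, `(p₁+2)² ∤ m` ⟹ every Hodge `(p₁+1)`-multiset of `ℤ/m` is pairs, or `p₁ ∣ m` and it is `σ_{p₁,A}`), `reach_general₂`, `allUnit_paired_general₂`,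
and **`hodgeConjectureFor_general₂`**: HC for every smooth projective complex Fermat `(p₁−1)`-fold `X^{p₁−1}ₘ` of such a degree `m`, modulo the named facts S0 and
the stub statements S2↑, S2↓, S3a, S5 (c4's `hodgeConjectureFor_general` minus `htwin`; new degrees `m = 11·13·n` — `2431 = 11·13·17`, … — and `p₁ = 5` is the
tree's T6 `…CoprimeSixAll`).

PROVENANCE. Cell hodge-nonav (HUMAN RULING D-0038), planner seat p1 g33: chapter ROUTE-P1AF addenda ADD4 ∕ ADD5 (memos `HOME/memos/ROUTE-P1AF-ADD4.md`
b7ad80a65555c84d, `…-ADD5.md` ffaf9911041dfeba; referee PASS 0∕0: ref g52 REF-P1AF-ADD4.md 83f6fe06da4ed38e, ref g53 REF-P1AF-ADD5.md bcccb0bceb665800),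
frozen Sketch `HOME/p1/route/Sketch_P1AF_RGENTWIN_g33.lean` (sha16 596f05bb769cab0c, 1805 lines, namespaces `HodgeNonAV.P1AF.GenTwin` + the line's
`…CancelByAnyClaimLattice.PairedNull ∕ .CoprimeSix`, farm rc 0 / 0 sorries / axioms {propext, Classical.choice, Quot.sound}; re-elaborated 2026-08-28), split into
nine tree modules `…GeneralTwinSplit` → `…GeneralTwinLocal` → `…GeneralTwinLevel` → `…GeneralTwinLevelOne` → `…GeneralTwinGlue` → `…FibreOfTopLevelGeneralTwinKey` → `…FibreOfTopLevelGeneralTwin` →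
`…FibreOfProgressionGeneralTwin` → `…GeneralTwinPayoff` by planner p1 g34 (landing kit HOME/p1/landing/); proof bodies verbatim (cell namespace renamed
`…Theorems.CancelByAnyClaimLattice.GenTwin`); docstrings reworded per referee rider N-ADD4-1 (Aoki 1983 cites are METHOD attributions; the statements without
the twin exclusion are not in print). Target: lead c4's `CoprimeSix.hodgeConjectureFor_general` (`Theorems/…GeneralPayoff`) WITHOUT the hypothesis
`htwin : ¬ p₁ (p₁+2) ∣ m` — replaced by `(p₁+2)² ∤ m`. Land with `--supports stmt-HodgeConjecture-1334` (line `cancel-by-any-claim-lattice` of crux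
`HodgeFermatVarieties`, route `PadicSemiregularLift`). No instance, no new notation (the `local notation3` of Parts 2, 3 and 9 are the line's, verbatim from
`Theorems/PadicSemiregularLiftHodgeFermatVarietiesFibreOfBoundaryPow` ∕ `…GeneralPayoff`), no sorry, no new axiom.
HONEST SCOPE: the HC pay-off `hodgeConjectureFor_general₂` is MODULO the line's named facts (S0) and stub statements (S2↑, S2↓, S3a, S5), exactly as c4's
`hodgeConjectureFor_general`; Fermat varieties are dominated by abelian motives (inside the known AV region); NOTHING here proves the Hodge conjecture.
References (method): N. Aoki, Math. Ann. 266 (1983) Thm A′ (§7), Prop. 2.2, Prop. 6.4, §9 [cite: Aoki1983, Thm. A]; N. Aoki, J. Math. Soc. Japan 39 (1987)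
Thm 1-1, Thm 2-1 [cite: Aoki1987, Thm. 2-1]; T. Shioda, Proc. Japan Acad. 55 (1979) §2 Thm 1 [cite: Shioda1979PJA, Thm. 1].
-/

set_option linter.dupNamespace false

noncomputable section

open Finset
open Literature.AlgebraicGeometry.HodgeTheory Literature.AlgebraicGeometry.HodgeTheory.FermatCharacter
open Summit.HodgeConjecture.HodgeConjecture.Theorems.CancelByAnyClaimLattice
open Summit.HodgeConjecture.HodgeConjecture.Theorems.CancelByAnyClaimLattice.PairedNull

open CategoryTheory AlgebraicGeometry
open Literature.AlgebraicGeometry Literature.AlgebraicGeometry.Motives Literature.AlgebraicTopology.SingularHomology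

namespace Summit.HodgeConjecture.HodgeConjecture.Theorems.CancelByAnyClaimLattice.CoprimeSix

/-- `Supply[M]` — the printed supply of level `M` (local notation of the line, verbatim). -/
local notation3 (prettyPrint := false) "Supply[" M "]" =>
  ({s : Multiset (ZMod M) | ∃ a : ZMod M, a ≠ 0 ∧ s = ({a, -a} : Multiset (ZMod M))} ∪
    {s : Multiset (ZMod M) | IsHodgeMultiset s ∧ Multiset.card s = 4} ∪
    {s : Multiset (ZMod M) | IsHodgeMultiset s ∧ IsSemiDecomposable s} ∪
    {s : Multiset (ZMod M) | ∃ (p : ℕ) (a : ZMod M), p.Prime ∧ p ≠ 2 ∧ p ∣ M ∧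
        2 < (M / p) / Nat.gcd (ZMod.val a) (M / p) ∧
        s = Multiset.map (fun j : ℕ => a + (j : ZMod M) * ((M / p : ℕ) : ZMod M)) (Multiset.range p) +
              {-((p : ZMod M) * a)}} : Set (Multiset (ZMod M)))

/-- `Reach[M, s]` (local notation of the line, verbatim). -/
local notation3 (prettyPrint := false) "Reach[" M ", " s "]" =>
  ∃ P N : Multiset (Multiset (ZMod M)),
    (∀ u ∈ P, u ∈ Supply[M]) ∧ (∀ u ∈ N, u ∈ Supply[M]) ∧ s + Multiset.sum N = Multiset.sum P

/-- `LevelRaise[k, m, s]` (local notation of the line, verbatim). -/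
local notation3 (prettyPrint := false) "LevelRaise[" k ", " m ", " s "]" =>
  Multiset.map (fun a : ZMod m => ((k * ZMod.val a : ℕ) : ZMod (k * m))) s

/-- `StableReach[m, s]` (local notation of the line, verbatim). -/
local notation3 (prettyPrint := false) "StableReach[" m ", " s "]" => ∃ k : ℕ, 0 < k ∧ Reach[k * m, LevelRaise[k, m, s]]

/-- The statement of stub S2↑ (pull-back of claim along level raising). Local notation only, verbatim
`…DoublingHodge`. -/
local notation3 (prettyPrint := false) "LevelClaimPull" =>
  ∀ (m k r : ℕ) (α' : Fin (2 * r + 2) → ZMod m), 0 < k → (∀ i, α' i ≠ 0) →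
    FermatCharacter.Claim m r α' → FermatCharacter.Claim (k * m) r (fun i => ((k * (α' i).val : ℕ) : ZMod (k * m)))

/-- The statement of stub S2↓ (push-forward of claim along level raising). Local notation only, verbatim
`…DoublingHodge`. -/
local notation3 (prettyPrint := false) "LevelClaimPush" =>
  ∀ (m k r : ℕ) (α' : Fin (2 * r + 2) → ZMod m), 0 < k → (∀ i, α' i ≠ 0) →
    FermatCharacter.Claim (k * m) r (fun i => ((k * (α' i).val : ℕ) : ZMod (k * m))) → FermatCharacter.Claim m r α'

/-- The statement of stub S3a (Shioda's semi-decomposable supply is claimed). Local notation only, verbatim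
`…DoublingHodge`. -/
local notation3 (prettyPrint := false) "SemiClaim" =>
  ∀ (M : ℕ) [NeZero M] (s : Multiset (ZMod M)), IsHodgeMultiset s → IsSemiDecomposable s → ClaimMultiset M s

/-- The statement of stub S5 (eigenspace structure of `H²ᵖ(X²ᵖₘ)`, Ran Prop. 1.7) at every level. Local
notation only, verbatim `…DoublingHodge`. -/
local notation3 (prettyPrint := false) "EigenStructure" =>
  ∀ (m : ℕ) [NeZero m] ⦃p : ℕ⦄, 0 < p →
    (∀ α : Fin (2 * p + 2) → ZMod m, α ≠ 0 → (∃ i, α i = 0) → fermatEigenspace m α (2 * p) = ⊥) ∧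
    (fermatEigenspace m (0 : Fin (2 * p + 2) → ZMod m) (2 * p) ≤
      LinearMap.range (complexBetti.map (SmoothHypersurface.hypersurfaceι (fermatPolynomial ℂ (2 * p) m)) (2 * p)).hom) ∧
    (∀ (A : HodgeModel (2 * p) (fermatHypersurface (2 * p) m)) (β : Fin (2 * p + 2) → ZMod m),
      (∀ i, β i ≠ 0) →
      (∃ x ∈ fermatEigenspace m β (2 * p), x ≠ 0 ∧ A.pullback (2 * p) x ∈ A.hodgePQ (2 * p) p p) →
        2 * FermatCharacter.normSum β = m * (2 * p + 2))

/-! ### §1 GP: the classification of the Hodge `(p+1)`-multisets at a level of least prime `≥ p` -/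

/-- **Aoki's Theorem A one prime down WITHOUT the twin exclusion** (`p₁ ≥ 11` prime, all primes of `m` `≥ p₁`, `p₁² ∤ m`, `(p₁+2)² ∤ m`): pairs, or `p₁ ∣ m` and `σ_{p₁,A}` — c4's `stub_coprimeClassification_general` verbatim on top of `exists_fibre_of_not_paired_general₂`. (method after (method after [cite: Aoki1983, Thm. A′ (§7)]); statement: line `cancel-by-any-claim-lattice` ∕ cell hodge-nonav P1 g33; not in print) [cite: Aoki1987, Thm. 2-1 (p. 388)] -/
theorem coprimeClassification_general₂ {p₁ : ℕ} (hp₁ : p₁.Prime) (hp₁11 : 11 ≤ p₁) {m : ℕ} [NeZero m]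
    (hmin : ∀ q ∈ m.primeFactors, p₁ ≤ q) (hsq : ¬ p₁ * p₁ ∣ m) (hsq₂ : ¬ (p₁ + 2) * (p₁ + 2) ∣ m)
    {s : Multiset (ZMod m)} (hs : IsHodgeMultiset s) (hR : Multiset.card s = p₁ + 1) :
    (∃ Q : Multiset (ZMod m), (∀ a ∈ Q, a ≠ 0) ∧ s = Q + Q.map (fun a ↦ -a)) ∨ (p₁ ∣ m ∧ ∃ A : ZMod m, (p₁ : ZMod m) * A ≠ 0 ∧ s = (Multiset.range p₁).map (fun i : ℕ ↦ A + (i : ZMod m) * ((m / p₁ : ℕ) : ZMod m)) + {-((p₁ : ZMod m) * A)}) := by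
  have hp₁5 : 5 ≤ p₁ := le_trans (by norm_num) hp₁11
  have hm6 : m.Coprime 6 := coprime_six_of_le_of_mem_primeFactors hp₁5 hmin
  by_cases hsym : ∀ x : ZMod m, Multiset.count x s = Multiset.count (-x) s
  · exact Or.inl (exists_pairs_of_count_symm hm6 _ s rfl hs hsym)
  · push Not at hsym
    obtain ⟨hp, A, hA, hfib⟩ :=
      PairedNull.exists_fibre_of_not_paired_general₂ hp₁ hp₁11 hmin hsq hsq₂ hs hR hsym
    rcases stub_sigmaStd_of_fibre p₁ hp₁ hp₁5 m hmin hp s hs hR A hA hfib with h | h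
    · exact Or.inl h
    · exact Or.inr ⟨hp, A, hA, h⟩

/-- **Reachability without the twin exclusion.** (statement: line `cancel-by-any-claim-lattice` ∕ cell hodge-nonav P1 g33; not in print) [cite: Aoki1987, Thm. 1-1 and Thm. 2-1 (p. 388)] -/
theorem reach_general₂ {p₁ : ℕ} (hp₁ : p₁.Prime) (hp₁11 : 11 ≤ p₁) {m : ℕ} [NeZero m]
    (hmin : ∀ q ∈ m.primeFactors, p₁ ≤ q) (hsq : ¬ p₁ * p₁ ∣ m) (hsq₂ : ¬ (p₁ + 2) * (p₁ + 2) ∣ m)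
    {s : Multiset (ZMod m)} (hs : IsHodgeMultiset s) (hR : Multiset.card s = p₁ + 1) : Reach[m, s] :=
  stub_reach_of_pairedOrSigmaStd p₁ hp₁ (le_trans (by norm_num) hp₁11) m hmin s hs hR
    (coprimeClassification_general₂ hp₁ hp₁11 hmin hsq hsq₂ hs hR)

/-- **A Hodge `(p₁+1)`-multiset of UNITS at such a level is pairs** (Aoki's Thm A′ one prime down, twin core included). (method after (method after [cite: Aoki1983, Thm. A′ (§7)]); statement: line `cancel-by-any-claim-lattice` ∕ cell hodge-nonav P1 g33; not in print) -/
theorem allUnit_paired_general₂ {p₁ : ℕ} (hp₁ : p₁.Prime) (hp₁11 : 11 ≤ p₁) {m : ℕ} [NeZero m]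
    (hmin : ∀ q ∈ m.primeFactors, p₁ ≤ q) (hsq : ¬ p₁ * p₁ ∣ m) (hsq₂ : ¬ (p₁ + 2) * (p₁ + 2) ∣ m)
    {s : Multiset (ZMod m)} (hs : IsHodgeMultiset s) (hR : Multiset.card s = p₁ + 1) (hu : ∀ x ∈ s, IsUnit x) :
    ∃ Q : Multiset (ZMod m), (∀ a ∈ Q, a ≠ 0) ∧ s = Q + Q.map (fun a ↦ -a) := by
  rcases coprimeClassification_general₂ hp₁ hp₁11 hmin hsq hsq₂ hs hR with h | ⟨hp, A, _, hsA⟩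
  · exact h
  · exfalso
    have hmem : -((p₁ : ZMod m) * A) ∈ s := by
      rw [hsA]
      exact Multiset.mem_add.2 (Or.inr (Multiset.mem_singleton_self _))
    have hpu : IsUnit ((p₁ : ℕ) : ZMod m) :=
      isUnit_of_mul_isUnit_left ((IsUnit.neg_iff _).1 (hu _ hmem))
    exact (ZMod.isUnit_prime_iff_not_dvd hp₁).1 hpu hp

/-! ### Pay-off -/

/-- **HC FOR EVERY SMOOTH PROJECTIVE COMPLEX FERMAT `(p₁−1)`-FOLD `X^{p₁−1}ₘ` OF A DEGREE `m` ALL OF WHOSE PRIME FACTORS ARE `≥ p₁`, WITH `p₁² ∤ m` AND `(p₁+2)² ∤ m`** (`p₁ ≥ 11` prime) — c4's `hodgeConjectureFor_general` with the twin exclusion `p₁(p₁+2) ∤ m` REMOVED (granted the same named facts S0 and stub statements S2/S3a/S5). New instances: `X¹⁰ₘ` for `m = 11·13·n`, e.g. `m = 2431 = 11·13·17`; `X¹⁶ₘ`, `m = 17·19·n`; … (method after (method after [cite: Aoki1983, Thm. A′ (§7)]); statement: line `cancel-by-any-claim-lattice` ∕ cell hodge-nonav P1 g33; not in print) [cite: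 Aoki1987, Thm. 2-1 (p. 388)] [cite: Shioda1979PJA, §2 Thm. 1] -/
theorem hodgeConjectureFor_general₂
    (hJ : Aoki1987_claim_juxtaposition) (hC : Aoki1987_claim_of_claim_juxtaposition_paired)
    (hP : Shioda_claim_paired) (hNS : AokiShioda1983_eigenline_le_neronSeveri) (hS : Aoki1987_claim_pStandard)
    (hPull : LevelClaimPull) (hPush : LevelClaimPush) (h3a : SemiClaim) (h5 : EigenStructure)
    {p₁ : ℕ} (hp₁ : p₁.Prime) (hp₁11 : 11 ≤ p₁) {m : ℕ} [NeZero m]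
    (hmin : ∀ q ∈ m.primeFactors, p₁ ≤ q) (hsq : ¬ p₁ * p₁ ∣ m) (hsq₂ : ¬ (p₁ + 2) * (p₁ + 2) ∣ m)
    ⦃X : SchemeOver ℂ⦄ (hF : IsFermatVariety (p₁ - 1) m X) (hX : IsSmoothProjective (p₁ - 1) X) :
    HodgeConjectureFor (p₁ - 1) X := by
  -- adapted from the lead's skeleton (`hodgeConjectureFor_general_of_stubs`)
  obtain ⟨r, hr⟩ : ∃ r, p₁ = 2 * r + 1 := hp₁.odd_of_ne_two (by omega)
  have hp1 : p₁ - 1 = 2 * r := by omega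
  rw [hp1] at hF hX ⊢
  have hr0 : 0 < r := by omega
  refine hodgeConjectureFor_of_claims_dim (m := m) (p := r) hr0 (h5 m hr0).1 (h5 m hr0).2.1
    (h5 m hr0).2.2 (fun α hα ↦ ?_) hF hX
  have hs : IsHodgeMultiset (univ.val.map α) := hα.isHodgeMultiset
  have hcard : Multiset.card (univ.val.map α) = p₁ + 1 := by rw [card_univ_val_map]; omega
  have hs0 : univ.val.map α ≠ 0 := fun h0 ↦ by
    have h := congrArg Multiset.card h0
    rw [hcard, Multiset.card_zero] at h
    omega
  have hR : Reach[m, univ.val.map α] := reach_general₂ hp₁ hp₁11 hmin hsq hsq₂ hs hcard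
  exact (claimMultiset_univ_val_map_iff α).1
    (Doubling.claimMultiset_of_stableReach hJ hC hP hNS hS hPull hPush h3a hs0 hs
      (Doubling.stableReach_of_reach hR))

end Summit.HodgeConjecture.HodgeConjecture.Theorems.CancelByAnyClaimLattice.CoprimeSix

end
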